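import Literature.MathematicalPhysics.QuantumFieldTheory.Balaban1983to89.B9B8KnitLetterE12Sup
import Literature.MathematicalPhysics.QuantumFieldTheory.Balaban1983to89.B9B8KnitLetterEntriesTransfer
import Literature.MathematicalPhysics.QuantumFieldTheory.Balaban1983to89.B9Thm37GpTorusRegularEntries

/-!
# `Balaban1983to89.B9B8KnitLetterE12GradFromM55` — THE JUNCTION COMPOSED WITH MODULE M5.5, LEFT ENTRIES: Theorem 3.7's cube data AT def-Y's LETTER OF
# RECORD `parSymY` ⇒ the (3.42)₂-type majorant of `D·η²G′(U; parKnitY)` for ANY real-coordinate left factor `D` AT PRINT's TRANSPORTERS ⇒ the consumer's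
# (E12) GRADIENT line there (junction J-B file 16: `B9Thm37GpTorusRegularEntries.hasMajorant_left_conj_Gp_of_cubes` + `…Regular.hasMajorant_conj_Gp_of_cubes`
# ∘ file 10 ∘ file 11 — the companion of file 15 for the weighted-gradient half of (1.101))

statement-level skeleton of published theorems with citation tags; proofs where landed; nothing here is a claim about the
Yang–Mills mass gap

T. Bałaban, *Propagators for lattice gauge theories in a background field*, Commun. Math. Phys. **99** (1985) 389–434 [`Balaban1985BackgroundPropagators`,
"[B9]"]; T. Bałaban, *Propagators and renormalization transformations for lattice gauge theories. II*, Commun. Math. Phys. **96** (1984) 223–250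
[`Balaban1984PropagatorsII`, "[4]"]; T. Bałaban, *Spaces of regular gauge field configurations on a lattice and gauge fixing conditions*, Commun. Math.
Phys. **99** (1985) 75–102 [`Balaban1985RegularSpaces`, "[B8]"].

THE PRINT.  [B9] Thm 3.1 (3.42)₂ p. 397 (the gradient entry `|(∇_UG′(U))(x, y)| ≤ B₀(Lʲη)e^{−δ₀d}`-type bound), p. 409 «The expansion is convergent in all norms
appearing in the inequalities (3.42)–(3.47)», p. 410; [4] Prop. 2.2 (2.64)–(2.67) p. 234; [B8] (1.101) p. 93 `|∇_{U₀}G′f|₍₁₎ ≦ B_G|f|₍₋₂₎` — the gradient half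
of the consumer's (E12).

WHY THIS FILE ∕ THE ARGUMENT.  M5.5's `hasMajorant_left_conj_Gp_of_cubes` (p21) gives, for ANY letter `G′` with `G′Δ′_a = 1` and ANY real-coordinate left
factor `E_b`, the majorant `A_E c₁(α₁)(1 − N′θc₁(α₁))⁻¹·W(y)·e^{−(1−α₁)δ₀d}` of `E_b·conj b(η²G′)` from the cube data (the block majorants `K_{E,□}` of the cube
terms, (3.88), (3.89)); with M5.5's plain majorant of `conj b(η²G′)` (file 15's input) both live at the letter of record `parSymY` and at the same rate
`(1−α₁)δ₀`.  Junction file 10 (`hasMajorant_left_conj_GpY_parKnitY_of_parSymY_len`) transports the left entry to `parKnitY` (`DG′_k = DG′_s + (DG′_s)(EG′_k)`,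
[4] Lemma 2.1 again at `α₂`), and file 11 (`wt_norm_cdS_GpKnitY_apply_le`) reads the consumer's weighted gradient line off the majorant with the left factor
`E_b = conj b(η⁻¹∇_{U,μ})`, weight `W = ℓ`.

CITATION HEADER (lean-in-tree rule).  Cell `lit-balaban`, sub-row G-B9-LETTERS, junction J-B file 16 → seat `lit-balaban-p33` gen 94.  REUSED BY NAME:
`B9Thm37GpTorusRegular.hasMajorant_conj_Gp_of_cubes`, `B9Thm37GpTorusRegularEntries.hasMajorant_left_conj_Gp_of_cubes` (M5.5, p21), junction files 10
(`B9B8KnitLetterEntriesTransfer.hasMajorant_left_conj_GpY_parKnitY_of_parSymY_len`), 11 (`B9B8KnitLetterE12Sup.wt_norm_cdS_GpKnitY_apply_le`),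
`B9Thm311DeltaPrimePos.isUnit_deltaPrimeAY_parSymY`, `Node00.GpY_mul_deltaPrimeAY`, `B9Eq352GradLetters.diffLetter`, `B6RandomWalk.c1_nonneg`.

WHAT THIS FILE PROVES (sorry-free; no definitions; nothing of [B9]'s analysis asserted).
* ★★★ **`hasMajorant_left_conj_GpY_parKnitY_of_cubes`** — cube data at `parSymY` (plain + left-entry block majorants for a left factor `E_b`, weight `W ≥ 0`) ⇒
  `E_b·conj b(η²G′(U; parKnitY))` has the majorant `A_E′(1 + c₁(α₂)θ₂c₁(α₂)(1 − θ₂c₁(α₂))⁻¹)·W(y)·e^{−(1−α₂)(1−α₁)δ₀d}`, `A_E′ = A_E c₁(α₁)(1 − N′θc₁(α₁))⁻¹`,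
  `θ₂ = 32(d+1)²α₀′(M₂Σ‖b_j‖)A₁`, `A₁ = N B₀c₁(α₁)(1 − N′θc₁(α₁))⁻¹`;
* ★★★ **`wt_norm_cdS_GpKnitY_apply_le_of_cubes`** — the consumer's (E12) GRADIENT line AT THE KNIT LETTER: with `E_b = conj b(η⁻¹∇_{U,μ})`, `W = ℓ`, a corner-free
  section, a constant-level-`n` member and a row-sum constant: `(Lʲη)·η⁻¹‖(∇_{U,μ}GpKnitY η U Λ)(z)‖ ≤ (Σ‖b_j‖)·A_E′(1 + …)·c·M₂·r` whenever `(Lⁿη)²‖Λ(w)‖ ≤ r`, `j ≤ n`.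

HONEST SCOPE.  Pure composition of landed theorems; all analytic inputs (Theorem 3.7's cube data at `parSymY`, the block majorants `K_{E,□}` of the gradient
of the cube terms — Cor. 3.6's second entry —, two Lemma 2.1 instances, smallness, row sum) remain displayed hypotheses exactly as in M5.5.  Count-neutral;
nothing continuum, nothing about OS axioms or the mass gap.  No `sorry`, no `axiom`, no `instance`, no `notation`.  NEW file; nothing landed is modified.
Net new unproved facts: 0.  Seat `lit-balaban-p33` gen 94, 2026-08-28.
-/

noncomputable section

namespace Literature.MathematicalPhysics.QuantumFieldTheory.Balaban1983to89.B9B8KnitLetterE12GradFromM55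

open Node00 B6KLevelCensusIndexV1 B6Geom246MultiLevelBox B9BackgroundsKLevelV1 B9Thm311DeltaPrimePos
open B6RandomWalk (HasMajorant Triangle254 Ineq261 Ineq263 c1_nonneg)
open B9Thm34Ext (toB6)
open B9GeoNormsKLevelV1 (geo9K geo9K_len_kGeo)
open B9Eq352DivFormLetters (conj)
open B9Eq352GradLetters (diffLetter)
open B9Ineq349SiteComposite (etaS_pos)
open B6Ineq2142KLevelV1 (β)
open B7Prop2Explicit (AvgClosed pdev C0 c2')
open B9B8CarrierDictionary (liftCfg)
open B9B8AveragingJunction (parKnitY)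
open B9Thm311PositivityKnitLetter (GpKnitY)
open B9Thm37GpTorusRegular (hasMajorant_conj_Gp_of_cubes)
open B9Thm37GpTorusRegularEntries (hasMajorant_left_conj_Gp_of_cubes)
open B9B8KnitLetterEntriesTransfer (hasMajorant_left_conj_GpY_parKnitY_of_parSymY_len)
open B9B8KnitLetterE12Sup (wt_norm_cdS_GpKnitY_apply_le)
open scoped Matrix Matrix.Norms.L2Operator

variable {d ℓ : ℕ} {hd : 1 ≤ d + 1} {hL : Odd (ℓ + 1) ∧ 1 < ℓ + 1} {b₀ b₁ : ℝ}
variable (i : KIdx d ℓ hd hL b₀ b₁) {N : ℕ} {G : Subgroup (Matrix (Fin N) (Fin N) ℂ)ˣ}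
variable {ι : Type} [Fintype ι] [DecidableEq ι] (b : Module.Basis ι ℝ (Matrix (Fin N) (Fin N) ℂ))
variable [Fintype (geo9K i).Site] [DecidableEq (geo9K i).Site] {Rr : ℝ} {Hp : Prop} (ιB : BlkY i → IBondY i)

/-- ★★★ **M5.5's CUBE DATA AT THE LETTER OF RECORD ⇒ THE LEFT-ENTRY MAJORANT OF `E_b·η²G′(U; parKnitY)` AT PRINT's TRANSPORTERS**, for ANY real-coordinate
left factor `E_b` and weight `W ≥ 0`: the hypotheses of file 15's `hasMajorant_conj_GpY_parKnitY_of_cubes` (plain cube data, first Lemma 2.1 at `(δ₀, α₁)`),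
the left-entry cube data of `B9Thm37GpTorusRegularEntries.hasMajorant_left_conj_Gp_of_cubes` (block majorants `K_{E,□}` of `E_b·conj b(η²T_□)` summing to
`A_E·W·e^{−δ₀d}`), and the transfer's second Lemma 2.1 at `((1−α₁)δ₀, α₂)` with `0 ≤ α₂(1−α₁)δ₀` and `θ₂c₁(α₂) < 1`.
[cite: Balaban1985BackgroundPropagators, Thm 3.1 (3.42)₂ p.397, Thm 3.7 (3.87)–(3.90) pp.409–410, (3.19) p.393; Balaban1984PropagatorsII, Prop 2.2 (2.64)–(2.67) p.234, Lemma 2.1 (2.61) p.234] -/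
theorem hasMajorant_left_conj_GpY_parKnitY_of_cubes [Nonempty (Fin N)] (hG : G ≤ B7Prop2Explicit.unitaryUnits (Matrix (Fin N) (Fin N) ℂ))
    (hGa : AvgClosed (d + 1) (ℓ + 1) G) {U : CfgY (Matrix (Fin N) (Fin N) ℂ) i} (hU : ∀ μ x, U μ x ∈ G)
    {α₀' : ℝ} (hα : 0 < α₀') (hα3 : C0 (d + 1) * α₀' ≤ 1 / 3) (hα2 : 2 * α₀' ≤ c2' (d + 1) (ℓ + 1))
    (h52 : pdev (liftCfg U) < α₀' * ((((ℓ + 1 : ℕ) : ℝ) ^ i.k)⁻¹) ^ 2) (hcf : i.cf = (((ℓ + 1 : ℕ) : ℝ)) ^ i.k)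
    {M₂ : ℝ} (hM₂ : 0 ≤ M₂) (hrepr : ∀ (v : Matrix (Fin N) (Fin N) ℂ) (j : ι), |b.repr v j| ≤ M₂ * ‖v‖)
    (htri : Triangle254 (toB6 (geo9K i) Rr Hp)) (hrefl : ∀ y : (geo9K i).Site, (geo9K i).dist y y = 0)
    (hdnn : ∀ y y' : (geo9K i).Site, 0 ≤ (geo9K i).dist y y')
    -- Theorem 3.7's data at the letter of record
    (d₁ : ℕ) {δ₀ α₁ θ B₀ Nn Nn' A : ℝ} {κ : Type} [Fintype κ] (S S' : κ → Finset (geo9K i).Site)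
    (T R : κ → Module.End ℝ (SiteY i → Matrix (Fin N) (Fin N) ℂ))
    (Eb : Module.End ℝ (SiteY i × ι → ℝ)) (W : (geo9K i).Site → ℝ) (KE : κ → (geo9K i).Site → (geo9K i).Site → ℝ)
    (hB₀ : 0 ≤ B₀) (hθ : 0 ≤ θ) (hN : 0 ≤ Nn) (hN' : 0 ≤ Nn') (hA : 0 ≤ A) (hW : ∀ a, 0 ≤ W a) (hαδ₁ : 0 ≤ (1 - α₁) * δ₀)
    (h261₁ : Ineq261 d₁ (toB6 (geo9K i) Rr Hp) δ₀ α₁) (h263₁ : Ineq263 d₁ (toB6 (geo9K i) Rr Hp) δ₀ α₁)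
    (hsmall₁ : Nn' * θ * B6.c1 d₁ δ₀ α₁ < 1)
    (hT : ∀ k, HasMajorant (g := toB6 (geo9K i) Rr Hp) (fun p : SiteY i × ι => ιB (blkOf i.D.toDomains p.1)) (conj b ((etaS i ^ 2) • T k))
      (fun a a' => if a ∈ S k then B₀ * (geo9K i).len a ^ 2 * Real.exp (-(δ₀ * (geo9K i).dist a a')) else 0))
    (hcnt : ∀ a : (geo9K i).Site, (∑ k, if a ∈ S k then (1 : ℝ) else 0) ≤ Nn)
    (hTE : ∀ k, HasMajorant (g := toB6 (geo9K i) Rr Hp) (fun p : SiteY i × ι => ιB (blkOf i.D.toDomains p.1))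
      (Eb * conj b ((etaS i ^ 2) • T k)) (KE k))
    (hKE : ∀ a a', (∑ k, KE k a a') ≤ A * W a * Real.exp (-(δ₀ * (geo9K i).dist a a')))
    (h389 : ∀ k, HasMajorant (g := toB6 (geo9K i) Rr Hp) (fun p : SiteY i × ι => ιB (blkOf i.D.toDomains p.1)) (conj b (R k))
      (fun a a' => if a ∈ S' k then θ * Real.exp (-(δ₀ * (geo9K i).dist a a')) else 0))
    (hcnt' : ∀ a : (geo9K i).Site, (∑ k, if a ∈ S' k then (1 : ℝ) else 0) ≤ Nn')
    (h388 : (deltaPrimeAY i (parSymY i) U).restrictScalars ℝ * (∑ k, T k) = 1 - ∑ k, R k)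
    -- the transfer's second Lemma 2.1 and smallness
    (d₂ : ℕ) {α₂ : ℝ} (hαδ₂ : 0 ≤ (1 - α₂) * ((1 - α₁) * δ₀)) (hαδ₂' : 0 ≤ α₂ * ((1 - α₁) * δ₀))
    (h261₂ : Ineq261 d₂ (toB6 (geo9K i) Rr Hp) ((1 - α₁) * δ₀) α₂) (h263₂ : Ineq263 d₂ (toB6 (geo9K i) Rr Hp) ((1 - α₁) * δ₀) α₂)
    (hsmall₂ : (32 * ((d : ℝ) + 1) ^ 2 * α₀' * (M₂ * ∑ j, ‖b j‖) * (Nn * B₀ * B6.c1 d₁ δ₀ α₁ * (1 - Nn' * θ * B6.c1 d₁ δ₀ α₁)⁻¹))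
      * B6.c1 d₂ ((1 - α₁) * δ₀) α₂ < 1) :
    HasMajorant (g := toB6 (geo9K i) Rr Hp) (fun p : SiteY i × ι => ιB (blkOf i.D.toDomains p.1))
      (Eb * conj b ((etaS i ^ 2) • (GpY i (parKnitY i) U).restrictScalars ℝ))
      (fun a a' => (A * B6.c1 d₁ δ₀ α₁ * (1 - Nn' * θ * B6.c1 d₁ δ₀ α₁)⁻¹)
          * (1 + B6.c1 d₂ ((1 - α₁) * δ₀) α₂
              * ((32 * ((d : ℝ) + 1) ^ 2 * α₀' * (M₂ * ∑ j, ‖b j‖) * (Nn * B₀ * B6.c1 d₁ δ₀ α₁ * (1 - Nn' * θ * B6.c1 d₁ δ₀ α₁)⁻¹))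
                  * B6.c1 d₂ ((1 - α₁) * δ₀) α₂
                * (1 - (32 * ((d : ℝ) + 1) ^ 2 * α₀' * (M₂ * ∑ j, ‖b j‖) * (Nn * B₀ * B6.c1 d₁ δ₀ α₁ * (1 - Nn' * θ * B6.c1 d₁ δ₀ α₁)⁻¹))
                    * B6.c1 d₂ ((1 - α₁) * δ₀) α₂)⁻¹))
          * W a * Real.exp (-((1 - α₂) * ((1 - α₁) * δ₀) * (geo9K i).dist a a'))) := by
  have hinv : (GpY i (parSymY i) U).restrictScalars ℝ * (deltaPrimeAY i (parSymY i) U).restrictScalars ℝ = 1 :=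
    LinearMap.ext fun Λ => LinearMap.congr_fun (GpY_mul_deltaPrimeAY i (parSymY i) U (isUnit_deltaPrimeAY_parSymY i hG hU)) Λ
  have hinvf : ∀ {x : ℝ}, x < 1 → 0 ≤ (1 - x)⁻¹ := fun h => inv_nonneg.2 (by linarith)
  -- M5.5 at the letter of record: the plain majorant and the left entry, same rate `(1−α₁)δ₀`
  have hGs := hasMajorant_conj_Gp_of_cubes i b ιB d₁ S S' T R (etaS_pos i).ne' hB₀ hθ hN hN' hαδ₁ htri hrefl hdnn h261₁ h263₁ hsmall₁ hT hcnt h389 hcnt'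
    hinv h388
  have hD := hasMajorant_left_conj_Gp_of_cubes i b ιB d₁ S' T R Eb W KE (etaS_pos i).ne' hA hW hθ hN' hαδ₁ htri hrefl hdnn h261₁ h263₁ hsmall₁ hTE hKE
    h389 hcnt' hinv h388
  have hA₁ : 0 ≤ Nn * B₀ * B6.c1 d₁ δ₀ α₁ * (1 - Nn' * θ * B6.c1 d₁ δ₀ α₁)⁻¹ :=
    mul_nonneg (mul_nonneg (mul_nonneg hN hB₀) (c1_nonneg _ _ _)) (hinvf hsmall₁)
  have hAE : 0 ≤ A * B6.c1 d₁ δ₀ α₁ * (1 - Nn' * θ * B6.c1 d₁ δ₀ α₁)⁻¹ :=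
    mul_nonneg (mul_nonneg hA (c1_nonneg _ _ _)) (hinvf hsmall₁)
  exact hasMajorant_left_conj_GpY_parKnitY_of_parSymY_len i b ιB hG hGa hU hα hα3 hα2 h52 hcf hM₂ hrepr d₂ hA₁ hAE hW hαδ₂ hαδ₂' htri hrefl hdnn
    h261₂ h263₂ rfl hsmall₂ Eb hGs hD

/-- ★★★ **THE CONSUMER's (E12) GRADIENT LINE AT THE KNIT LETTER FROM M5.5's CUBE DATA** ([B8] (1.101) `|∇_{U₀}G′f|₍₁₎ ≦ B_G|f|₍₋₂₎`): the hypotheses of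
`hasMajorant_left_conj_GpY_parKnitY_of_cubes` with the left factor `E_b = conj b(η⁻¹∇_{U,μ})` (`η = etaS i`) and weight `W = ℓ`, a corner-free section
`ιB`, a constant-level-`n` member and a row-sum constant `c` for `e^{−(1−α₂)(1−α₁)δ₀d}`: for `η > 0`, every `Λ` with `(Lⁿη)²‖Λ(w)‖ ≤ r` and every weight
level `j ≤ n`, `(Lʲη)·η⁻¹·‖(∇_{U,μ}(GpKnitY η U Λ))(z)‖ ≤ (Σ‖b_j‖)·A_E′(1 + c₁θ₂c₁(1 − θ₂c₁)⁻¹)·c·M₂·r`.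
[cite: Balaban1985RegularSpaces, (1.101) p.93, (1.1) p.76; Balaban1985BackgroundPropagators, Thm 3.1 (3.42)₂ p.397, (3.3) p.390, Thm 3.7 pp.409–410; Balaban1984PropagatorsII, (2.61) p.234] -/
theorem wt_norm_cdS_GpKnitY_apply_le_of_cubes [Nonempty (Fin N)] (hG : G ≤ B7Prop2Explicit.unitaryUnits (Matrix (Fin N) (Fin N) ℂ))
    (hGa : AvgClosed (d + 1) (ℓ + 1) G) {U : CfgY (Matrix (Fin N) (Fin N) ℂ) i} (hU : ∀ μ x, U μ x ∈ G)
    {α₀' : ℝ} (hα : 0 < α₀') (hα3 : C0 (d + 1) * α₀' ≤ 1 / 3) (hα2 : 2 * α₀' ≤ c2' (d + 1) (ℓ + 1))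
    (h52 : pdev (liftCfg U) < α₀' * ((((ℓ + 1 : ℕ) : ℝ) ^ i.k)⁻¹) ^ 2) (hcf : i.cf = (((ℓ + 1 : ℕ) : ℝ)) ^ i.k)
    (hι : ∀ s, β i.hN i.D i.hk (ιB s) = s) {n : ℕ} (hlev : ∀ z : SiteY i, levY i z = n) (μ : Fin (d + 1))
    {M₂ : ℝ} (hM₂ : 0 ≤ M₂) (hrepr : ∀ (v : Matrix (Fin N) (Fin N) ℂ) (j : ι), |b.repr v j| ≤ M₂ * ‖v‖)
    (htri : Triangle254 (toB6 (geo9K i) Rr Hp)) (hrefl : ∀ y : (geo9K i).Site, (geo9K i).dist y y = 0)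
    (hdnn : ∀ y y' : (geo9K i).Site, 0 ≤ (geo9K i).dist y y')
    (d₁ : ℕ) {δ₀ α₁ θ B₀ Nn Nn' A : ℝ} {κ : Type} [Fintype κ] (S S' : κ → Finset (geo9K i).Site)
    (T R : κ → Module.End ℝ (SiteY i → Matrix (Fin N) (Fin N) ℂ)) (KE : κ → (geo9K i).Site → (geo9K i).Site → ℝ)
    (hB₀ : 0 ≤ B₀) (hθ : 0 ≤ θ) (hN : 0 ≤ Nn) (hN' : 0 ≤ Nn') (hA : 0 ≤ A) (hαδ₁ : 0 ≤ (1 - α₁) * δ₀)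
    (h261₁ : Ineq261 d₁ (toB6 (geo9K i) Rr Hp) δ₀ α₁) (h263₁ : Ineq263 d₁ (toB6 (geo9K i) Rr Hp) δ₀ α₁)
    (hsmall₁ : Nn' * θ * B6.c1 d₁ δ₀ α₁ < 1)
    (hT : ∀ k, HasMajorant (g := toB6 (geo9K i) Rr Hp) (fun p : SiteY i × ι => ιB (blkOf i.D.toDomains p.1)) (conj b ((etaS i ^ 2) • T k))
      (fun a a' => if a ∈ S k then B₀ * (geo9K i).len a ^ 2 * Real.exp (-(δ₀ * (geo9K i).dist a a')) else 0))
    (hcnt : ∀ a : (geo9K i).Site, (∑ k, if a ∈ S k then (1 : ℝ) else 0) ≤ Nn)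
    (hTE : ∀ k, HasMajorant (g := toB6 (geo9K i) Rr Hp) (fun p : SiteY i × ι => ιB (blkOf i.D.toDomains p.1))
      (conj b (diffLetter (shiftY i) (UboxY i U) ((((etaS i : ℝ) : ℂ))⁻¹) (Sum.inl μ)) * conj b ((etaS i ^ 2) • T k)) (KE k))
    (hKE : ∀ a a', (∑ k, KE k a a') ≤ A * (geo9K i).len a * Real.exp (-(δ₀ * (geo9K i).dist a a')))
    (h389 : ∀ k, HasMajorant (g := toB6 (geo9K i) Rr Hp) (fun p : SiteY i × ι => ιB (blkOf i.D.toDomains p.1)) (conj b (R k))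
      (fun a a' => if a ∈ S' k then θ * Real.exp (-(δ₀ * (geo9K i).dist a a')) else 0))
    (hcnt' : ∀ a : (geo9K i).Site, (∑ k, if a ∈ S' k then (1 : ℝ) else 0) ≤ Nn')
    (h388 : (deltaPrimeAY i (parSymY i) U).restrictScalars ℝ * (∑ k, T k) = 1 - ∑ k, R k)
    (d₂ : ℕ) {α₂ : ℝ} (hαδ₂ : 0 ≤ (1 - α₂) * ((1 - α₁) * δ₀)) (hαδ₂' : 0 ≤ α₂ * ((1 - α₁) * δ₀))
    (h261₂ : Ineq261 d₂ (toB6 (geo9K i) Rr Hp) ((1 - α₁) * δ₀) α₂) (h263₂ : Ineq263 d₂ (toB6 (geo9K i) Rr Hp) ((1 - α₁) * δ₀) α₂)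
    (hsmall₂ : (32 * ((d : ℝ) + 1) ^ 2 * α₀' * (M₂ * ∑ j, ‖b j‖) * (Nn * B₀ * B6.c1 d₁ δ₀ α₁ * (1 - Nn' * θ * B6.c1 d₁ δ₀ α₁)⁻¹))
      * B6.c1 d₂ ((1 - α₁) * δ₀) α₂ < 1)
    {c : ℝ} (hrow : ∀ a : (geo9K i).Site, ∑ a' : (geo9K i).Site, Real.exp (-((1 - α₂) * ((1 - α₁) * δ₀) * (geo9K i).dist a a')) ≤ c)
    {η : ℝ} (hη : 0 < η) (Λ : SiteY i → Matrix (Fin N) (Fin N) ℂ) {r : ℝ} (hΛ : ∀ w, ((((ℓ + 1 : ℕ) : ℝ)) ^ n * η) ^ 2 * ‖Λ w‖ ≤ r)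
    {j : ℕ} (hj : j ≤ n) (z : SiteY i) :
    ((((ℓ + 1 : ℕ) : ℝ)) ^ j * η) * (η⁻¹ * ‖cdS i U μ (GpKnitY i η U Λ) z‖) ≤ (∑ j, ‖b j‖)
      * ((A * B6.c1 d₁ δ₀ α₁ * (1 - Nn' * θ * B6.c1 d₁ δ₀ α₁)⁻¹)
          * (1 + B6.c1 d₂ ((1 - α₁) * δ₀) α₂
              * ((32 * ((d : ℝ) + 1) ^ 2 * α₀' * (M₂ * ∑ j, ‖b j‖) * (Nn * B₀ * B6.c1 d₁ δ₀ α₁ * (1 - Nn' * θ * B6.c1 d₁ δ₀ α₁)⁻¹))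
                  * B6.c1 d₂ ((1 - α₁) * δ₀) α₂
                * (1 - (32 * ((d : ℝ) + 1) ^ 2 * α₀' * (M₂ * ∑ j, ‖b j‖) * (Nn * B₀ * B6.c1 d₁ δ₀ α₁ * (1 - Nn' * θ * B6.c1 d₁ δ₀ α₁)⁻¹))
                    * B6.c1 d₂ ((1 - α₁) * δ₀) α₂)⁻¹)))
      * c * M₂ * r := by
  have hlen0 : ∀ a : (geo9K i).Site, 0 ≤ (geo9K i).len a := fun a => by
    rw [geo9K_len_kGeo]; exact (B6KLevelCensusIndexV1.len_pos i a).le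
  have hK := hasMajorant_left_conj_GpY_parKnitY_of_cubes i b ιB hG hGa hU hα hα3 hα2 h52 hcf hM₂ hrepr htri hrefl hdnn d₁ S S' T R
    (conj b (diffLetter (shiftY i) (UboxY i U) ((((etaS i : ℝ) : ℂ))⁻¹) (Sum.inl μ))) (fun a => (geo9K i).len a) KE hB₀ hθ hN hN' hA hlen0 hαδ₁
    h261₁ h263₁ hsmall₁ hT hcnt hTE hKE h389 hcnt' h388 d₂ hαδ₂ hαδ₂' h261₂ h263₂ hsmall₂
  -- the constant in front is nonnegative
  have hinvf : ∀ {x : ℝ}, x < 1 → 0 ≤ (1 - x)⁻¹ := fun h => inv_nonneg.2 (by linarith)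
  set θ₂ : ℝ := (32 * ((d : ℝ) + 1) ^ 2 * α₀' * (M₂ * ∑ j, ‖b j‖) * (Nn * B₀ * B6.c1 d₁ δ₀ α₁ * (1 - Nn' * θ * B6.c1 d₁ δ₀ α₁)⁻¹)) with hθ₂
  have hSb : 0 ≤ ∑ j, ‖b j‖ := Finset.sum_nonneg fun _ _ => norm_nonneg _
  have hA₁ : 0 ≤ Nn * B₀ * B6.c1 d₁ δ₀ α₁ * (1 - Nn' * θ * B6.c1 d₁ δ₀ α₁)⁻¹ :=
    mul_nonneg (mul_nonneg (mul_nonneg hN hB₀) (c1_nonneg _ _ _)) (hinvf hsmall₁)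
  have hθ₂0 : 0 ≤ θ₂ := by rw [hθ₂]; positivity
  have hAE : 0 ≤ A * B6.c1 d₁ δ₀ α₁ * (1 - Nn' * θ * B6.c1 d₁ δ₀ α₁)⁻¹ :=
    mul_nonneg (mul_nonneg hA (c1_nonneg _ _ _)) (hinvf hsmall₁)
  have hconst : 0 ≤ (A * B6.c1 d₁ δ₀ α₁ * (1 - Nn' * θ * B6.c1 d₁ δ₀ α₁)⁻¹)
      * (1 + B6.c1 d₂ ((1 - α₁) * δ₀) α₂ * (θ₂ * B6.c1 d₂ ((1 - α₁) * δ₀) α₂ * (1 - θ₂ * B6.c1 d₂ ((1 - α₁) * δ₀) α₂)⁻¹)) :=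
    mul_nonneg hAE (add_nonneg zero_le_one (mul_nonneg (c1_nonneg _ _ _)
      (mul_nonneg (mul_nonneg hθ₂0 (c1_nonneg _ _ _)) (hinvf hsmall₂))))
  exact wt_norm_cdS_GpKnitY_apply_le i b ιB hι hlev hcf U μ hconst hK hrow hM₂ hrepr hη Λ hΛ hj z

end Literature.MathematicalPhysics.QuantumFieldTheory.Balaban1983to89.B9B8KnitLetterE12GradFromM55

end
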